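import Summits.ResolutionOfSingularities.ResolutionOfSingularities.Theorems.PicoverLocalModel.Negative.FiniteTypeLoadBearing
import Summits.ResolutionOfSingularities.ResolutionOfSingularities.Theorems.PicoverLocalModel.Negative.WeakResolutionFiniteNormalization
import Mathlib.FieldTheory.PurelyInseparable.Basic

/-!
# Negative lemma for crux `PicoverLocalModel` (stmt-ResolutionOfSingularities-0557): finite type
# over a field (excellence) is load-bearing — UNCONDITIONALLY

Companion of `FiniteTypeLoadBearing.lean` (statement modulo the link `hL`) and
`WeakResolutionFiniteNormalization.lean` (the link, proved: `finite_of_hasResolution`). Here the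
two are combined: the hypothesis `hL` is replaced by an explicit valuation ring `W` of `F`
containing `S` and `y` and integral over `S` (abstract form
`not_hasResolution_localModel_of_valuationSubring`), which at F. K. Schmidt's ring is the valuation
ring of `F = K(f) ⊆ 𝔽_p((X))` for the restricted `X`-adic valuation (every element of `F` has a
`p`-power in `K`, `F/K` being purely inseparable). Consequences, sorry-free and unconditional:
`not_hasResolution_localModel_schmidt'`, `picoverLocalModel_false_without_finiteType_at'` (every
prime), `picoverLocalModel_false_without_finiteType'` — **any proof of the crux must use
`Algebra.FiniteType k R`.** [cite: Kollar2007, Example 1.103 and Claim 1.104]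
-/

noncomputable section

open CategoryTheory AlgebraicGeometry TopologicalSpace Polynomial
open Literature.AlgebraicGeometry.Resolution
open Literature.Barriers.ResolutionOfSingularities.QuasiExcellence

set_option linter.dupNamespace false

namespace Summit.ResolutionOfSingularities.ResolutionOfSingularities.Theorems.PicoverLocalModel.Negative

/-- **Abstract unconditional form of the counterexample.** As
`not_hasResolution_localModel_of_nonFiniteIntegralClosure`, with the link `hL` replaced by a
valuation ring `W` of `F` containing `S` and the generator `y` and integral over `S` (no
hypothesis on `S` beyond being a domain, none on `a` beyond `y^p = a`): then
`Spec (S[T]/(T^p - a))_red ≅ Spec S[y]` has no resolution in the weak sense.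
[cite: Kollar2007, Example 1.103 and Claim 1.104] -/
theorem not_hasResolution_localModel_of_valuationSubring {S K F : Type} [CommRing S]
    [IsDomain S] [Field K] [Algebra S K] [IsFractionRing S K] [Field F]
    [Algebra K F] [Algebra S F] [IsScalarTower S K F] {p : ℕ} (hp : 0 < p) (a : S)
    (pb : PowerBasis K F)
    (hypow : pb.gen ^ p = algebraMap S F a) (hmin : (minpoly K pb.gen).degree = p)
    (W : ValuationSubring F) (hyW : pb.gen ∈ W) (hSW : ∀ s : S, algebraMap S F s ∈ W)
    (hW : ∀ w : W, IsIntegral S (w : F))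
    (hnf : ¬ Module.Finite S (integralClosure S F)) :
    ¬ Scheme.HasResolution
      (Spec (.of (AdjoinRoot (X ^ p - C a) ⧸ nilradical (AdjoinRoot (X ^ p - C a))))) := by
  set y := pb.gen with hy
  have hyint : IsIntegral S y := Nagata1962.isIntegral_of_pow_eq hp.ne' hypow
  set R := Algebra.adjoin S {y} with hR
  haveI : Module.Finite S R :=
    ⟨(Submodule.fg_top (Subalgebra.toSubmodule R)).mpr hyint.fg_adjoin_singleton⟩
  haveI : IsFractionRing R F :=
    Nagata1962.isFractionRing_subalgebra pb R (Algebra.self_mem_adjoin_singleton _ _)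
  obtain ⟨e'⟩ := nonempty_localModelRing_equiv_adjoin K hp a y hypow hmin
  intro hres
  have hres' : Scheme.HasResolution (Spec (.of R)) :=
    hres.of_iso (Spec.map e'.symm.toCommRingCatIso.hom)
  -- `R ⊆ W ⊆ F` as a tower of algebras, `W` integral over `R`
  let WS : Subalgebra S F :=
    { W.toSubring with
      algebraMap_mem' := hSW }
  have hRW : R ≤ WS := by
    rw [hR, Algebra.adjoin_le_iff, Set.singleton_subset_iff]
    exact hyW
  letI : Algebra S W := ((algebraMap S F).codRestrict W hSW).toAlgebra
  haveI : IsScalarTower S W F := IsScalarTower.of_algebraMap_eq fun _ => rfl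
  letI : Algebra R W := ((algebraMap R F).codRestrict W fun r => hRW r.2).toAlgebra
  haveI : IsScalarTower R W F := IsScalarTower.of_algebraMap_eq fun _ => rfl
  haveI : IsScalarTower S R W := IsScalarTower.of_algebraMap_eq fun _ => rfl
  have hWF : Function.Injective (algebraMap W F) := Subtype.val_injective
  haveI : Algebra.IsIntegral R W := ⟨fun w => by
    have h1 : IsIntegral S w := (isIntegral_algebraMap_iff hWF).mp (hW w)
    exact h1.tower_top⟩
  -- the link: `W` is a finite `R`-module, hence a finite `S`-module …
  have hfin : Module.Finite R W := finite_of_hasResolution (B := R) (F := F) W hres'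
  haveI : Module.Finite S W := Module.Finite.trans R W
  -- … and the integral closure of `S` in `F` is `W`
  apply hnf
  haveI : IsIntegrallyClosed W := inferInstance
  let ι : W →ₗ[S] integralClosure S F :=
    { toFun := fun w => ⟨(w : F), hW w⟩
      map_add' := fun _ _ => rfl
      map_smul' := fun s w => Subtype.ext (by
        change ((algebraMap S W s * w : W) : F) = s • (w : F)
        rw [Algebra.smul_def]; rfl) }
  refine Module.Finite.of_surjective ι fun x => ?_
  have hx' : IsIntegral S (x : F) := x.2
  have hx : IsIntegral W (x : F) := hx'.tower_top
  obtain ⟨w, hw⟩ := (IsIntegrallyClosed.isIntegral_iff (R := W) (K := F)).mp hx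
  exact ⟨w, Subtype.ext hw⟩

section Schmidt

open IntermediateField
open scoped LaurentSeries PowerSeries

variable (p : ℕ) [hp : Fact p.Prime] (K : IntermediateField (ZMod p) (ZMod p)⸨X⸩) (f : (ZMod p)⟦X⟧)
variable (ht : (HahnSeries.single 1 1 : (ZMod p)⸨X⸩) ∈ K)
  (hzp : (f : (ZMod p)⸨X⸩) ^ p ∈ K) (hz : (f : (ZMod p)⸨X⸩) ∉ K)
  (hvz : Valued.v (f : (ZMod p)⸨X⸩) < 1)

include hvz in
/-- The valuation ring `F ∩ 𝔽_p⟦X⟧` of `F = K(f)` contains the generator `f`. [folklore] -/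
theorem gen_mem_valuationSubring :
    (AdjoinSimple.gen K (f : (ZMod p)⸨X⸩) : ↥K⟮(f : (ZMod p)⸨X⸩)⟯) ∈
      (Valued.v.comap (algebraMap (↥K⟮(f : (ZMod p)⸨X⸩)⟯) (ZMod p)⸨X⸩)).valuationSubring := by
  rw [Valuation.mem_valuationSubring_iff, Valuation.comap_apply]
  exact hvz.le

/-- Elements of `S = K ∩ 𝔽_p⟦X⟧` lie in `F ∩ 𝔽_p⟦X⟧`. [folklore] -/
theorem algebraMap_mem_valuationSubring [Algebra (Valued.v.comap (algebraMap K (ZMod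
      p)⸨X⸩)).valuationSubring (↥K⟮(f : (ZMod p)⸨X⸩)⟯)] [IsScalarTower (Valued.v.comap (algebraMap K
      (ZMod p)⸨X⸩)).valuationSubring K (↥K⟮(f : (ZMod p)⸨X⸩)⟯)]
    (s : (Valued.v.comap (algebraMap K (ZMod p)⸨X⸩)).valuationSubring) :
    algebraMap _ (↥K⟮(f : (ZMod p)⸨X⸩)⟯) s ∈
      (Valued.v.comap (algebraMap (↥K⟮(f : (ZMod p)⸨X⸩)⟯) (ZMod p)⸨X⸩)).valuationSubring := by
  rw [Valuation.mem_valuationSubring_iff, Valuation.comap_apply,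
    IsScalarTower.algebraMap_apply _ K (↥K⟮(f : (ZMod p)⸨X⸩)⟯)]
  exact s.2

include hzp in
/-- Every element of `F ∩ 𝔽_p⟦X⟧` is integral over `S = K ∩ 𝔽_p⟦X⟧`: `F/K` is purely inseparable,
so some `p`-power of it lies in `K`, with absolute value `≤ 1`. [folklore] -/
theorem isIntegral_of_mem_valuationSubring [Algebra (Valued.v.comap (algebraMap K (ZMod
      p)⸨X⸩)).valuationSubring (↥K⟮(f : (ZMod p)⸨X⸩)⟯)] [IsScalarTower (Valued.v.comap (algebraMap K
      (ZMod p)⸨X⸩)).valuationSubring K (↥K⟮(f : (ZMod p)⸨X⸩)⟯)]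
    (w : (Valued.v.comap (algebraMap (↥K⟮(f : (ZMod p)⸨X⸩)⟯) (ZMod p)⸨X⸩)).valuationSubring) :
    IsIntegral (Valued.v.comap (algebraMap K (ZMod p)⸨X⸩)).valuationSubring
      (w : ↥K⟮(f : (ZMod p)⸨X⸩)⟯) := by
  haveI := Literature.AlgebraicGeometry.Resolution.SchmidtDefect.isPurelyInseparable_gen p K
    (f : (ZMod p)⸨X⸩) hzp
  haveI : CharP (ZMod p)⸨X⸩ p :=
    Literature.AlgebraicGeometry.Resolution.SchmidtDefect.charP_laurentSeries p
  haveI : CharP K p := (algebraMap K (ZMod p)⸨X⸩).charP Subtype.val_injective p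
  haveI : ExpChar K p := ExpChar.prime hp.out
  obtain ⟨n, k, hk⟩ := IsPurelyInseparable.pow_mem K p (w : ↥K⟮(f : (ZMod p)⸨X⸩)⟯)
  -- `|k| = |w|^(p^n) ≤ 1`, so `k ∈ S`
  have hkS : k ∈ (Valued.v.comap (algebraMap K (ZMod p)⸨X⸩)).valuationSubring := by
    rw [Valuation.mem_valuationSubring_iff, Valuation.comap_apply]
    have hw := w.2
    rw [Valuation.mem_valuationSubring_iff, Valuation.comap_apply] at hw
    have : (algebraMap K (ZMod p)⸨X⸩ k) =
        (algebraMap (↥K⟮(f : (ZMod p)⸨X⸩)⟯) (ZMod p)⸨X⸩ (w : ↥K⟮(f : (ZMod p)⸨X⸩)⟯)) ^ p ^ n := by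
      rw [← map_pow, ← hk, ← IsScalarTower.algebraMap_apply]
    rw [this, Valuation.map_pow]
    exact pow_le_one₀ zero_le hw
  refine Nagata1962.isIntegral_of_pow_eq (pow_ne_zero n hp.out.ne_zero) (s := ⟨k, hkS⟩) ?_
  rw [IsScalarTower.algebraMap_apply (Valued.v.comap (algebraMap K (ZMod p)⸨X⸩)).valuationSubring K
    (↥K⟮(f : (ZMod p)⸨X⸩)⟯)]
  exact hk.symm

include ht hz hvz in
/-- **At F. K. Schmidt's discrete valuation ring the local model has no resolution —
unconditionally.** [cite: Kollar2007, Example 1.103 and Claim 1.104] -/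
theorem not_hasResolution_localModel_schmidt'
    (a : (Valued.v.comap (algebraMap K (ZMod p)⸨X⸩)).valuationSubring)
    (ha : (a : K) = ⟨(f : (ZMod p)⸨X⸩) ^ p, hzp⟩) :
    ¬ Scheme.HasResolution
      (Spec (.of (AdjoinRoot (X ^ p - C a) ⧸ nilradical (AdjoinRoot (X ^ p - C a))))) := by
  letI : Algebra (Valued.v.comap (algebraMap K (ZMod p)⸨X⸩)).valuationSubring (↥K⟮(f : (ZMod
      p)⸨X⸩)⟯) := ((algebraMap K (↥K⟮(f : (ZMod p)⸨X⸩)⟯)).comp (algebraMap (Valued.v.comap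
      (algebraMap K (ZMod p)⸨X⸩)).valuationSubring K)).toAlgebra
  haveI : IsScalarTower (Valued.v.comap (algebraMap K (ZMod p)⸨X⸩)).valuationSubring K (↥K⟮(f :
      (ZMod p)⸨X⸩)⟯) := IsScalarTower.of_algebraMap_eq fun _ => rfl
  have hypow : (adjoin.powerBasis (Literature.AlgebraicGeometry.Resolution.SchmidtDefect.isIntegral_gen
      p K (f : (ZMod p)⸨X⸩) hzp)).gen ^ p = algebraMap (Valued.v.comap (algebraMap K (ZMod
        p)⸨X⸩)).valuationSubring (↥K⟮(f : (ZMod p)⸨X⸩)⟯) a := by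
    rw [adjoin.powerBasis_gen, IsScalarTower.algebraMap_apply (Valued.v.comap (algebraMap K (ZMod
      p)⸨X⸩)).valuationSubring K (↥K⟮(f : (ZMod p)⸨X⸩)⟯)]
    change _ = algebraMap K (↥K⟮(f : (ZMod p)⸨X⸩)⟯) (a : K)
    rw [ha]
    exact Nagata1962.gen_pow_eq p K f hzp
  have hmin : (minpoly K (adjoin.powerBasis
      (Literature.AlgebraicGeometry.Resolution.SchmidtDefect.isIntegral_gen p K (f : (ZMod p)⸨X⸩)
        hzp)).gen).degree = p := by
    rw [adjoin.powerBasis_gen, IntermediateField.minpoly_gen,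
      Literature.AlgebraicGeometry.Resolution.SchmidtDefect.minpoly_gen p K (f : (ZMod p)⸨X⸩) hzp hz,
      degree_X_pow_sub_C hp.out.pos]
  have hyW : (adjoin.powerBasis (Literature.AlgebraicGeometry.Resolution.SchmidtDefect.isIntegral_gen
      p K (f : (ZMod p)⸨X⸩) hzp)).gen ∈
      (Valued.v.comap (algebraMap (↥K⟮(f : (ZMod p)⸨X⸩)⟯) (ZMod p)⸨X⸩)).valuationSubring := by
    rw [adjoin.powerBasis_gen]
    exact gen_mem_valuationSubring p K f hvz
  exact not_hasResolution_localModel_of_valuationSubring hp.out.pos a _ hypow hmin _ hyW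
    (algebraMap_mem_valuationSubring p K f) (isIntegral_of_mem_valuationSubring p K f hzp)
    (Nagata1962.not_finite_integralClosure_adjoin p K f ht hzp hz)

/-- **At every prime the crux with `Algebra.FiniteType k R` dropped fails — unconditionally.**
Witness: `k = 𝔽_p`, `R = S` Schmidt's discrete valuation ring, `a = f^p`.
[cite: Kollar2007, Example 1.103 and Claim 1.104] -/
theorem picoverLocalModel_false_without_finiteType_at' :
    ¬ ∀ (k : Type) [Field k] [CharP k p] (R : Type) [CommRing R] [IsDomain R]
      [Algebra k R], IsRegularRing R → ∀ a : R,
        Scheme.HasResolution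
          (Spec (.of (AdjoinRoot (X ^ p - C a) ⧸ nilradical (AdjoinRoot (X ^ p - C a))))) := by
  intro h
  obtain ⟨f, K, ht, hzp, hz, hvz⟩ := Nagata1962.exists_data p
  haveI := Nagata1962.isDiscreteValuationRing p K ht
  haveI := Nagata1962.charP_valuationSubring p K
  letI : Algebra (ZMod p) (Valued.v.comap (algebraMap K (ZMod p)⸨X⸩)).valuationSubring :=
    ZMod.algebra _ p
  exact not_hasResolution_localModel_schmidt' p K f ht hzp hz hvz
    ⟨⟨(f : (ZMod p)⸨X⸩) ^ p, hzp⟩, Nagata1962.pow_p_mem p K f hzp hvz⟩ rfl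
    (h (ZMod p) (Valued.v.comap (algebraMap K (ZMod p)⸨X⸩)).valuationSubring inferInstance _)

end Schmidt

/-- **Any proof of the crux must use `Algebra.FiniteType k R` — unconditionally** (the statement
with that hypothesis dropped is false already at `p = 2`).
[cite: Kollar2007, Example 1.103 and Claim 1.104] -/
theorem picoverLocalModel_false_without_finiteType' :
    ¬ ∀ p : ℕ, p.Prime → ∀ (k : Type) [Field k] [CharP k p] (R : Type) [CommRing R] [IsDomain R]
      [Algebra k R], IsRegularRing R → ∀ a : R,
        Scheme.HasResolution
          (Spec (.of (AdjoinRoot (X ^ p - C a) ⧸ nilradical (AdjoinRoot (X ^ p - C a))))) :=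
  fun h =>
    haveI : Fact (Nat.Prime 2) := ⟨Nat.prime_two⟩
    picoverLocalModel_false_without_finiteType_at' 2 (h 2 Nat.prime_two)

end Summit.ResolutionOfSingularities.ResolutionOfSingularities.Theorems.PicoverLocalModel.Negative

end
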